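import Summits.CriticalPhenomena.CardyFormulaZ2.Theses.CardyRotToConf
import Literature.Probability.RandomPlanarGeometry.ChordalCurveFamilyProofs
import Summits.CriticalPhenomena.CardyFormulaZ2.Theorems.CardyRotToConfR2SymmetryUpgrade.Negative.SurgStopAtMeasurable
import HarnessLib

/-!
# Normalising a domain-Markov extension at pasts that have reached the target
# (fat-germ one-shot surgery for crux `CardyRotToConfR2SymmetryUpgrade`, stmt-CriticalPhenomena-0698)

The typed Markov kernel `Q D past` of a chordal family `P` is unconstrained at pasts of `P D`-measure
zero. For families whose curves reach the target `b = D.pt 1` only at the very end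
(`NoEarlyTarget`: no representative visits `b` and then leaves it — true for chordal SLE₆,
`stub_sleNoEarlyTarget`), the kernel may be NORMALISED to the Dirac mass at the constant curve at
`b` on every past whose tip is `b`, and remains a Markov extension (`exists_isMarkovExtension_normalized`).
The surgery's kernel uses this normal form to be a well-defined function of (remaining domain, tip,
target) also at tips equal to the target.

Main statements: `startFrom_eq_const_of_target_stopAt` (deterministic: if a representative that
visits `b` stays at `b`, then `tip = b` forces the restarted class to be the constant class),
`isMarkovExtension_normalize`, `exists_isMarkovExtension_normalized`.
Negative lane: no Theses statement is asserted.
-/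

noncomputable section

open Set Filter Topology Metric MeasureTheory
open scoped unitInterval ENNReal

namespace Summit.CriticalPhenomena.CardyFormulaZ2.Theorems.CardyRotToConfR2SymmetryUpgrade.Negative

open Literature.Probability.RandomPlanarGeometry Literature.Probability.RandomPlanarGeometry.ChordalFamily

/-- **No early target** (a regularity clause, hypothesis of the surgery): no representative of a
`P D`-typical class visits `b = D.pt 1` and then leaves it. [folklore] -/
def NoEarlyTarget (P : ChordalFamily) : Prop :=
  ∀ D : DobrushinDomain, ∀ᵐ γ ∂(P D), ∀ c : Curve ℂ, CurveClass.mk c = γ →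
    ∀ s t : unitInterval, s ≤ t → c s = D.pt 1 → c t = D.pt 1

/-! ### Deterministic part: tip `b` forces a constant future -/

section Deterministic

variable {b : ℂ} {F : Set ℂ}

/-- If a curve stays at `b` once it visits `b`, and its stopped piece at `F` ends at `b`, then its
restarted piece is the constant curve at `b`. [folklore] -/
theorem Curve.startFrom_eq_const_of_stays {c : Curve ℂ}
    (hstay : ∀ s t : I, s ≤ t → c s = b → c t = b) (htip : (c.stopAt F).target = b) :
    c.startFrom F = Curve.const b := by
  rw [Curve.target_stopAt] at htip
  refine Curve.ext (ContinuousMap.ext fun s => ?_)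
  show c.startFrom F s = Curve.const b s
  rw [Curve.startFrom_apply, Curve.const_apply]
  refine hstay ⟨c.hitParam F, c.hitParam_mem_Icc F⟩ _ ?_ htip
  show c.hitParam F ≤ (projIcc 0 1 zero_le_one (c.hitParam F + (1 - c.hitParam F) * s) : ℝ)
  have hT := c.hitParam_mem_Icc F
  have hmem : c.hitParam F + (1 - c.hitParam F) * s ∈ Icc (0 : ℝ) 1 :=
    ⟨by nlinarith [hT.1, hT.2, s.2.1], by nlinarith [hT.1, hT.2, s.2.1, s.2.2]⟩
  rw [projIcc_of_mem _ hmem]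
  show c.hitParam F ≤ c.hitParam F + (1 - c.hitParam F) * s
  nlinarith [hT.2, s.2.1]

/-- **Class level.** For closed `F`: if every representative of `γ` stays at `b` once it visits
`b`, and the tip of `γ` stopped at `F` is `b`, then `γ` restarted at `F` is the constant class at
`b`. [folklore] -/
theorem startFrom_eq_const_of_target_stopAt (hF : IsClosed F) {γ : CurveClass ℂ}
    (hstay : ∀ c : Curve ℂ, CurveClass.mk c = γ → ∀ s t : I, s ≤ t → c s = b → c t = b)
    (htip : (CurveClass.stopAt F γ).target = b) :
    CurveClass.startFrom F γ = CurveClass.mk (Curve.const b) := by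
  have hout : CurveClass.mk γ.out = γ := CurveClass.mk_out γ
  have htip' : (γ.out.stopAt F).target = b := by
    rw [← hout, CurveClass.stopAt_mk_holds F hF, CurveClass.target_mk] at htip
    exact htip
  rw [← hout, CurveClass.startFrom_mk_holds F hF,
    Curve.startFrom_eq_const_of_stays (hstay γ.out hout) htip']

end Deterministic

/-! ### The normalised kernel -/

section Normalize

variable {P : ChordalFamily} {Q : DobrushinDomain → CurveClass ℂ → Measure (CurveClass ℂ)}

/-- The kernel normalised to `δ_{const b}` at pasts whose tip is the target `b`. [folklore] -/
def normalizeKernel (Q : DobrushinDomain → CurveClass ℂ → Measure (CurveClass ℂ)) :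
    DobrushinDomain → CurveClass ℂ → Measure (CurveClass ℂ) := fun D p =>
  open scoped Classical in
  if p.target = D.pt 1 then Measure.dirac (CurveClass.mk (Curve.const (D.pt 1))) else Q D p

/-- Value of the normalised kernel at a past with tip `b`. [folklore] -/
theorem normalizeKernel_of_eq {D : DobrushinDomain} {p : CurveClass ℂ} (h : p.target = D.pt 1) :
    normalizeKernel Q D p = Measure.dirac (CurveClass.mk (Curve.const (D.pt 1))) := by
  simp [normalizeKernel, h]

/-- Value of the normalised kernel at a past with tip off `b`. [folklore] -/
theorem normalizeKernel_of_ne {D : DobrushinDomain} {p : CurveClass ℂ} (h : p.target ≠ D.pt 1) :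
    normalizeKernel Q D p = Q D p := by
  simp [normalizeKernel, h]

/-- The set of classes whose tip at `F` is `b` is measurable. [folklore] -/
theorem measurableSet_setOf_target_stopAt_eq {F : Set ℂ} (hF : IsClosed F) (b : ℂ) :
    MeasurableSet {γ : CurveClass ℂ | (CurveClass.stopAt F γ).target = b} := by
  have : {γ : CurveClass ℂ | (CurveClass.stopAt F γ).target = b} =
      CurveClass.stopAt F ⁻¹' (CurveClass.target ⁻¹' {b}) := rfl
  rw [this]
  exact measurableSet_preimage_stopAt hF
    (CurveClass.lipschitzWith_target.continuous.measurable (measurableSet_singleton b))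

/-- **Normalising preserves the Markov extension property** when the family has no early target.
[folklore] -/
theorem isMarkovExtension_normalize (hQ : P.IsMarkovExtension Q) (hN : NoEarlyTarget P) :
    P.IsMarkovExtension (normalizeKernel Q) := by
  refine ⟨fun D => ?_, fun D F hF A B hA hB => ?_, fun D₁ D₂ p₁ p₂ hrem ht h1 => ?_⟩
  · -- initial: the trivial past has tip `a ≠ b`
    have hne : (CurveClass.mk (Curve.const (D.pt 0))).target ≠ D.pt 1 := by
      rw [CurveClass.target_mk, Curve.target_def, Curve.const_apply]
      exact fun h => absurd (D.pt_injective h) (by decide)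
    rw [normalizeKernel_of_ne hne, hQ.initial]
  · -- markov: split the past event along `tip = b`
    set Tb : Set (CurveClass ℂ) := {γ | (CurveClass.stopAt F γ).target = D.pt 1} with hTb
    have hTbm : MeasurableSet Tb := measurableSet_setOf_target_stopAt_eq hF (D.pt 1)
    have hSA : MeasurableSet (CurveClass.stopAt F ⁻¹' A) := measurableSet_preimage_stopAt hF hA
    have hSB : MeasurableSet (CurveClass.startFrom F ⁻¹' B) := measurableSet_preimage_startFrom hF hB
    -- on `Tb` the future is a.s. the constant class
    have hconst : ∀ᵐ γ ∂(P D), γ ∈ Tb → CurveClass.startFrom F γ = CurveClass.mk (Curve.const (D.pt 1)) := by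
      filter_upwards [hN D] with γ hγ hγT
      exact startFrom_eq_const_of_target_stopAt hF hγ hγT
    -- decompose both sides
    have hsplitL : P D (CurveClass.stopAt F ⁻¹' A ∩ CurveClass.startFrom F ⁻¹' B) =
        P D (CurveClass.stopAt F ⁻¹' A ∩ CurveClass.startFrom F ⁻¹' B ∩ Tb) +
        P D (CurveClass.stopAt F ⁻¹' A ∩ CurveClass.startFrom F ⁻¹' B ∩ Tbᶜ) := by
      rw [← measure_inter_add_sdiff _ hTbm, sdiff_eq]
    have hsplitR : ∫⁻ γ in CurveClass.stopAt F ⁻¹' A, normalizeKernel Q D (CurveClass.stopAt F γ) B ∂(P D) =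
        ∫⁻ γ in CurveClass.stopAt F ⁻¹' A ∩ Tb, normalizeKernel Q D (CurveClass.stopAt F γ) B ∂(P D) +
        ∫⁻ γ in CurveClass.stopAt F ⁻¹' A ∩ Tbᶜ, normalizeKernel Q D (CurveClass.stopAt F γ) B ∂(P D) := by
      rw [← lintegral_inter_add_sdiff _ (CurveClass.stopAt F ⁻¹' A) hTbm, sdiff_eq]
    rw [hsplitL, hsplitR]
    congr 1
    · -- the `tip = b` part: both sides are `1_B(const b) · P D (A-part ∩ Tb)`
      have hval : ∀ γ ∈ CurveClass.stopAt F ⁻¹' A ∩ Tb, normalizeKernel Q D (CurveClass.stopAt F γ) B =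
          B.indicator 1 (CurveClass.mk (Curve.const (D.pt 1))) := by
        intro γ hγ
        rw [normalizeKernel_of_eq hγ.2, Measure.dirac_apply' _ hB]
      rw [setLIntegral_congr_fun (hSA.inter hTbm) hval, setLIntegral_const]
      by_cases hmem : CurveClass.mk (Curve.const (D.pt 1)) ∈ B
      · rw [indicator_of_mem hmem, Pi.one_apply, one_mul]
        refine measure_congr ?_
        filter_upwards [hconst] with γ hγ
        show (γ ∈ CurveClass.stopAt F ⁻¹' A ∩ CurveClass.startFrom F ⁻¹' B ∩ Tb) =
          (γ ∈ CurveClass.stopAt F ⁻¹' A ∩ Tb)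
        refine propext ⟨fun h => ⟨h.1.1, h.2⟩, fun h => ⟨⟨h.1, ?_⟩, h.2⟩⟩
        show CurveClass.startFrom F γ ∈ B
        rw [hγ h.2]; exact hmem
      · rw [indicator_of_notMem hmem, zero_mul]
        refine (measure_congr ?_).trans measure_empty
        filter_upwards [hconst] with γ hγ
        refine propext ⟨fun h => ?_, fun h => False.elim h⟩
        have := h.1.2
        rw [mem_preimage, hγ h.2] at this
        exact hmem this
    · -- the `tip ≠ b` part: the kernel is unchanged, use `Q`'s identity for `A ∩ {target ≠ b}`
      have hA' : MeasurableSet (A ∩ {p : CurveClass ℂ | p.target ≠ D.pt 1}) :=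
        hA.inter (CurveClass.lipschitzWith_target.continuous.measurable
          (measurableSet_singleton (D.pt 1))).compl
      have hpre : CurveClass.stopAt F ⁻¹' (A ∩ {p : CurveClass ℂ | p.target ≠ D.pt 1}) =
          CurveClass.stopAt F ⁻¹' A ∩ Tbᶜ := rfl
      have key := hQ.markov D F hF _ B hA' hB
      rw [hpre] at key
      have hval : ∀ γ ∈ CurveClass.stopAt F ⁻¹' A ∩ Tbᶜ, normalizeKernel Q D (CurveClass.stopAt F γ) B =
          Q D (CurveClass.stopAt F γ) B := fun γ hγ => by rw [normalizeKernel_of_ne hγ.2]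
      rw [setLIntegral_congr_fun (hSA.inter hTbm.compl) hval, ← key, inter_right_comm]
  · -- domain
    by_cases h : p₁.target = D₁.pt 1
    · have h' : p₂.target = D₂.pt 1 := by rw [← ht, h, h1]
      rw [normalizeKernel_of_eq h, normalizeKernel_of_eq h', h1]
    · have h' : p₂.target ≠ D₂.pt 1 := by rwa [← ht, ← h1]
      rw [normalizeKernel_of_ne h, normalizeKernel_of_ne h', hQ.domain D₁ D₂ p₁ p₂ hrem ht h1]

/-- **A family with the domain Markov property and no early target has a NORMALISED Markov
extension**: `Q D p = δ_{const b}` whenever `p.target = b = D.pt 1`. [folklore] -/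
theorem exists_isMarkovExtension_normalized (hM : P.IsDomainMarkov) (hN : NoEarlyTarget P) :
    ∃ Q, P.IsMarkovExtension Q ∧ ∀ (D : DobrushinDomain) (p : CurveClass ℂ), p.target = D.pt 1 →
      Q D p = Measure.dirac (CurveClass.mk (Curve.const (D.pt 1))) := by
  obtain ⟨Q, hQ⟩ := hM
  exact ⟨normalizeKernel Q, isMarkovExtension_normalize hQ hN, fun D p hp => normalizeKernel_of_eq hp⟩

end Normalize

end Summit.CriticalPhenomena.CardyFormulaZ2.Theorems.CardyRotToConfR2SymmetryUpgrade.Negative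

end
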